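/-
Copyright: cell `pub-balaban-gaps` (G2), seat ne6 (row NE7b), `prover-pub-balaban-gaps-ne6-g15-0`. Project licence.
-/
import Summits.QuantumFields.BalabanUV.T4Continuum.Spine.NE7b.CompactFibreWindowSUNExplicit
import Summits.QuantumFields.BalabanUV.T4Continuum.Spine.NE7b.CompactFibreWindowSUNExplicitUpper

/-!
# THE EXPLICIT TWO-SIDED SMALL-BALL LAW FOR `SU(N)` (`N ≥ 1`), ASSEMBLED: `|−log Haar_{SU(N)}{‖V − 1‖_HS ≤ δ} − (N² − 1)·log δ⁻¹| ≤ C_N` with `C_N` a closed expression in `N`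
# (V33 `CompactFibreWindowSUNExplicit`: lower half from the tree's `B16ZLower`; V36 `CompactFibreWindowSUNExplicitUpper`: upper half from the determinant-window sandwich) (row NE7b, node U5c)

Cell `pub-balaban-gaps` (G2 spine census, V37) for the `pub-balaban` T⁴ crux NE7b (NOT PRINTED, NOT PROVED).  Junction only; no `def`; zero `sorry`; nothing of Bałaban's asserted.
`C_N := max(c_N^{(33)}, log π + log c_N + N²·log 5 + log vol b_{N²}(0,1))` where `c_N^{(33)} = ((N² − 1)∕2)·log N + N²·log(16π + 2) + log(2N + 1) − log(4π)` (V33) and `c_N` = Chatterjee's constant (V36).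

WHAT IS PROVED ([folklore]): **`abs_neg_log_haar_sball_sub_le_explicit`** (`0 < δ ≤ 1∕10`), and the region form **`abs_neg_log_pi_sball_sub_le_explicit`** (`|−log κ(Π_b SB δ) − #bonds·(N² − 1)·log δ⁻¹| ≤ #bonds·C_N`).
HONEST REMARKS.  V29 `CompactFibreWindowSUNRate.exists_abs_neg_log_haar_sball_sub_le` is the same pin with a SOFT constant on `0 < δ ≤ 2`; here the constant is VALUED on `0 < δ ≤ 1∕10`.  (A3)∕(A1c) NOT asserted.
NE7b NOT PRINTED ∕ NOT PROVED; spine PROVED 0∕9; rung (B)+1 on a FINITE torus — NOT infinite volume, NOT the mass gap, NOT Clay.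
HONEST DEPENDENCY: continuum YM on T⁴ ⇐ BetaPertH ∧ nine spine estimates (0/9 proved); BetaPertH ⇐ (D1) ∧ (D4) ∧ CAP+tail;
G-an2-4 gates asym, D1 and NE2/3/4.  This file changes none of it.
-/

set_option autoImplicit false

noncomputable section

open MeasureTheory Real Finset Metric
open scoped Matrix.Norms.Frobenius
open Literature.MathematicalPhysics.QuantumFieldTheory (haarProbability)
open Literature.MathematicalPhysics.QuantumFieldTheory.UnitaryCayley (haarChartConst 𝔼)
open Summit.QuantumFields.BalabanUV.T4Continuum.NE7b.CompactFibreWindowSUNExplicit (neg_log_haar_sball_le_explicit haar_sball_real_pos)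
open Summit.QuantumFields.BalabanUV.T4Continuum.NE7b.CompactFibreWindowSUNExplicitUpper (le_neg_log_haar_sball_explicit)

namespace Summit.QuantumFields.BalabanUV.T4Continuum.NE7b.CompactFibreWindowSUNExplicitTwoSided

variable {N : ℕ} [NeZero N]

/-- **THE EXPLICIT TWO-SIDED PIN** (`N ≥ 1`, `0 < δ ≤ 1∕10`): `|−log Haar_{SU(N)}{‖V − 1‖_HS ≤ δ} − (N² − 1)·log δ⁻¹| ≤ max(c_N^{(33)}, log π + log c_N + N²·log 5 + log vol b(0,1))`. [folklore] -/
theorem abs_neg_log_haar_sball_sub_le_explicit {δ : ℝ} (hδ0 : 0 < δ) (hδ : δ ≤ 1 / 10) :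
    |-Real.log ((haarProbability (Matrix.specialUnitaryGroup (Fin N) ℂ)) {V : Matrix.specialUnitaryGroup (Fin N) ℂ | ‖(V : Matrix (Fin N) (Fin N) ℂ) - 1‖ ≤ δ}).toReal - ((N : ℝ) ^ 2 - 1) * Real.log δ⁻¹| ≤
      max (((N : ℝ) ^ 2 - 1) / 2 * Real.log N + (N : ℝ) ^ 2 * Real.log (16 * π + 2) + Real.log (2 * N + 1) - Real.log (4 * π))
        (Real.log π + Real.log (haarChartConst N : ℝ) + (N : ℝ) * N * Real.log 5 + Real.log (volume (closedBall (0 : 𝔼 N) 1)).toReal) := by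
  have hup := neg_log_haar_sball_le_explicit (N := N) hδ0 (by linarith)
  have hlow := le_neg_log_haar_sball_explicit (N := N) hδ0 hδ
  have hsq : (N : ℝ) * N * Real.log 5 = (N : ℝ) ^ 2 * Real.log 5 := by ring
  rw [measureReal_def] at hup
  rw [abs_le]
  constructor
  · linarith [le_max_right (((N : ℝ) ^ 2 - 1) / 2 * Real.log N + (N : ℝ) ^ 2 * Real.log (16 * π + 2) + Real.log (2 * N + 1) - Real.log (4 * π))
      (Real.log π + Real.log (haarChartConst N : ℝ) + (N : ℝ) * N * Real.log 5 + Real.log (volume (closedBall (0 : 𝔼 N) 1)).toReal)]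
  · linarith [le_max_left (((N : ℝ) ^ 2 - 1) / 2 * Real.log N + (N : ℝ) ^ 2 * Real.log (16 * π + 2) + Real.log (2 * N + 1) - Real.log (4 * π))
      (Real.log π + Real.log (haarChartConst N : ℝ) + (N : ℝ) * N * Real.log 5 + Real.log (volume (closedBall (0 : 𝔼 N) 1)).toReal)]

variable {B : Type*} [Fintype B]

/-- **THE REGION FORM**: `|−log κ(Π_b SB δ) − #bonds·(N² − 1)·log δ⁻¹| ≤ #bonds·max(…)` for `0 < δ ≤ 1∕10` (product Haar on `bonds → SU(N)`). [folklore] -/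
theorem abs_neg_log_pi_sball_sub_le_explicit {δ : ℝ} (hδ0 : 0 < δ) (hδ : δ ≤ 1 / 10) :
    |-Real.log ((Measure.pi fun _ : B => haarProbability (Matrix.specialUnitaryGroup (Fin N) ℂ)) (Set.univ.pi fun _ : B => {V : Matrix.specialUnitaryGroup (Fin N) ℂ | ‖(V : Matrix (Fin N) (Fin N) ℂ) - 1‖ ≤ δ})).toReal -
        (Fintype.card B : ℝ) * (((N : ℝ) ^ 2 - 1) * Real.log δ⁻¹)| ≤
      (Fintype.card B : ℝ) * max (((N : ℝ) ^ 2 - 1) / 2 * Real.log N + (N : ℝ) ^ 2 * Real.log (16 * π + 2) + Real.log (2 * N + 1) - Real.log (4 * π))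
        (Real.log π + Real.log (haarChartConst N : ℝ) + (N : ℝ) * N * Real.log 5 + Real.log (volume (closedBall (0 : 𝔼 N) 1)).toReal) := by
  have habs := abs_neg_log_haar_sball_sub_le_explicit (N := N) hδ0 hδ
  rw [CompactFibreWindowSUN.pi_sball_toReal_eq, Real.log_pow,
    show ∀ x y : ℝ, -((Fintype.card B : ℝ) * x) - (Fintype.card B : ℝ) * y = (Fintype.card B : ℝ) * (-x - y) from fun x y => by ring, abs_mul, Nat.abs_cast]
  exact mul_le_mul_of_nonneg_left habs (Nat.cast_nonneg _)

end Summit.QuantumFields.BalabanUV.T4Continuum.NE7b.CompactFibreWindowSUNExplicitTwoSided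

end
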